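import Literature.AnabelianGeometry.EtaleTheta.ClassicalThetaValues
import Literature.AnabelianGeometry.EtaleTheta.CyclotomicEnvelope

/-!
# Kernel DAG index — layer L2, part b (MACHINE DELTA-DRAFT by abc-iut-dag `tools/mkkernel.py` @2026-08-25T19:27Z: 2 landed nodes NOT YET in the tree index Summits/ABC/IUTFork/DAG*.lean filed by abc-iut-c312-2; spec v1.3)

THIS FILE PROVES NOTHING NEW AND ASSERTS NOTHING (plan/KERNEL-DAG-SPEC.md). It gives ONE NAME `N_<kernel_id>` to each DAG node whose
statement has LANDED through the gate, knitting the landed declarations BY NAME. Witness naming (c312-2 F1/F2, 18:39:37Z): `N_<id>_holds`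
exists iff the DAG row is `discharged(p)` (it IS the kernel-checked theorems); a landed row not yet marked discharged by its lead gets the same
conjunction witnessed as `N_<id>_part`; FACT-style `def … : Prop` claims get a name and no witness; CLAIM-FORM items ([IUTchIII] Cor 3.12,
[IUTchIV] Thm 1.10) are `abbrev N_<id> (X) : Prop := X.<Claim>` and the theorems that assume them are EDGES `E_<dst>_of_<src>` (no `__`). Nothing here says abc is proved or refuted or takes a side on [IUTchIII] Cor 3.12. typed ≠ discharged; indexed ≠ endorsed.
Filer of the tree copy: abc-iut-c312-2 (`Summits/ABC/IUTFork/DAGL2b.lean`); this draft is regenerated hourly and is not the tree.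
FILED COPY (abc-iut-c312-2, post-processed by work/fixdraft.py): claim nodes are claim-form abbrevs without `_holds`;
`_holds` only for DAG rows marked discharged, `_part` otherwise (spec §2(b),(c)); edges by name (§3).
-/

namespace Summit.ABC.IUTFork.DAG

namespace PartL2b
/-- `StatementOf h` is the statement (a `Prop`) of which the landed `h` is the proof: the index NAMES statements, it never re-types them. -/
abbrev StatementOf {P : Prop} (_h : P) : Prop := P
end PartL2b
open PartL2b

noncomputable section
universe u₁ u₂ u₃ u₄ u₅ u₆ u₇ u₈ u₉

/-- [node EtTh:Def1.9(ii) · L2/D1 · [EtTh] Def 1.9 (ii), kurims-ms p.27 · p404429 · claim · DAG status discharged(p404429)] decls 1 · cites→ EtTh:Prop1.4 -/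
abbrev N_EtTh_Def1_9_ii : Prop := StatementOf @Literature.AnabelianGeometry.EtaleTheta.thetaDdotTerm_sqrt_neg_one.{u₁}
/-- discharge of `N_EtTh_Def1_9_ii`: the landed theorems it names, BY NAME (spec §2(c)); proves nothing new. -/
theorem N_EtTh_Def1_9_ii_holds : N_EtTh_Def1_9_ii := @Literature.AnabelianGeometry.EtaleTheta.thetaDdotTerm_sqrt_neg_one

/-- [node EtTh:Def2.13(i) · L2/D1 · [EtTh] Def 2.13 (i), kurims-ms p.43 · p403739 · claim · DAG status discharged(p403739)] decls 11 · cites→ - -/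
def N_EtTh_Def2_13_i : Prop :=
  StatementOf @Literature.AnabelianGeometry.EtaleTheta.innerAut_normal.{u₁} ∧
  StatementOf @Literature.AnabelianGeometry.EtaleTheta.mem_contMulAut.{u₁} ∧
  StatementOf @Literature.AnabelianGeometry.EtaleTheta.innerAut_le_contMulAut.{u₁} ∧
  StatementOf @Literature.AnabelianGeometry.EtaleTheta.innerContAut_normal.{u₁}
/-- discharge of `N_EtTh_Def2_13_i`: the landed theorems it names, BY NAME (spec §2(c)); proves nothing new. -/
theorem N_EtTh_Def2_13_i_holds : N_EtTh_Def2_13_i := ⟨@Literature.AnabelianGeometry.EtaleTheta.innerAut_normal, @Literature.AnabelianGeometry.EtaleTheta.mem_contMulAut, @Literature.AnabelianGeometry.EtaleTheta.innerAut_le_contMulAut, @Literature.AnabelianGeometry.EtaleTheta.innerContAut_normal⟩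
example := @Literature.AnabelianGeometry.EtaleTheta.innerAut.{u₁}
example := @Literature.AnabelianGeometry.EtaleTheta.Out.{u₁}
example := @Literature.AnabelianGeometry.EtaleTheta.contMulAut.{u₁}
example := @Literature.AnabelianGeometry.EtaleTheta.innerContAut.{u₁}
example := @Literature.AnabelianGeometry.EtaleTheta.TopOut.{u₁}
example := @Literature.AnabelianGeometry.EtaleTheta.TopOut.mk.{u₁}

end

end Summit.ABC.IUTFork.DAG
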